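import Mathlib
import HarnessLib
import Summits.ValiantsHypothesis.ValiantsHypothesis.Theorems.LacunarySymmetroidMatrixDescartesOsculationLawPeelPrimeCurve

/-!
# ValiantsHypothesis / LacunarySymmetroid — crux `MatrixDescartes` (stmt-ValiantsHypothesis-18050, V1),
# line `Cruxes/MatrixDescartes/Lines/osculation_law.lean` («osculation-law»), stub `stub_recursion` (ROUTE′):
# `peelPrime` — THE CROSSING-TOLERANT PEEL INEQUALITY AT THE SPLITTING `(m, 0)`, PENCIL FORM

The statement of the line's `PeelInequalityAt m` specialised to `s = 0` (index `Fin m ⊕ Fin 0`), with the general-position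
conjunct `∂_bΦ ≠ 0` DROPPED (only arc avoidance `p 1 ≠ c * p 0 ^ N` is kept) and the osculation term `2 * #osc` replaced by
`2 * m * #osc`; every line definition unfolded verbatim (the token string staged as `p7g13-PeelPrime.sig.lean`, against which
val-lit-p4 g13 writes the node step `zmult_node_le′` of the recursion).  Proof: the pencil unfolding of `…PeelRankUnfold`
(`insertionPoly_rank_card`, `splits_letter_at`, `coeff_zero`, `coeff_top`, `insertedDet_eq_rank`) feeds `peel_curve_prime`; at
`s = 0` the top coefficient `a_m = det` of the `0 × 0` lower pencil is `1`, so the fibre is monic.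

* **`peelPrime (m)`**.

Honest framing: a helper THEOREM toward the OPEN stub `stub_recursion`; the osculation LAW, `MatrixDescartes` (18050) and
`VP ≠ VNP` are NOT proved.  No definitions, no named facts.
-/

-- `Summit.ValiantsHypothesis.ValiantsHypothesis.…` is the tree's mandated single-conjunct layout (Sub = Summit).
set_option linter.dupNamespace false

noncomputable section

namespace Summit.ValiantsHypothesis.ValiantsHypothesis.Theorems.LacunarySymmetroidMatrixDescartes

open Polynomial Set
open scoped BigOperators

namespace OsculationPeel

/-- At `s = 0` the lower-block pencil is a `0 × 0` matrix: its determinant is `1`. [folklore] -/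
theorem lowerDet_fin_zero (m : ℕ) {K : ℕ} (d : Fin K → ℕ) (S : Fin K → Matrix (Fin m ⊕ Fin 0) (Fin m ⊕ Fin 0) ℝ) :
    (∑ l, (X : ℝ[X]) ^ d l • ((S l).toBlocks₂₂).map Polynomial.C).det = 1 :=
  Matrix.det_isEmpty

/-- **`peelPrime`**: the crossing-tolerant peel inequality at the splitting `(m, 0)`, pencil form, every line definition
unfolded. [folklore] -/
theorem peelPrime (m : ℕ) :
    ∀ (K : ℕ) (d : Fin K → ℕ) (S : Fin K → Matrix (Fin m ⊕ Fin 0) (Fin m ⊕ Fin 0) ℝ) (c : ℝ) (N : ℕ),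
      (∀ l, (S l).IsSymm) → 0 < c → (∑ l, (X : ℝ[X]) ^ d l • (S l).map Polynomial.C).det ≠ 0 → (∑ l, (X : ℝ[X]) ^ d l • ((S l).toBlocks₂₂).map Polynomial.C).det ≠ 0 →
      {p : Fin 2 → ℝ | 0 < p 0 ∧ 0 < p 1 ∧ MvPolynomial.eval p (∑ l, (MvPolynomial.X (0 : Fin 2) : MvPolynomial (Fin 2) ℝ) ^ d l •
              (S l).map (MvPolynomial.C : ℝ →+* MvPolynomial (Fin 2) ℝ)
            + (MvPolynomial.X (1 : Fin 2) : MvPolynomial (Fin 2) ℝ) •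
              (Matrix.fromBlocks 1 0 0 0 : Matrix (Fin m ⊕ Fin 0) (Fin m ⊕ Fin 0) ℝ).map
                (MvPolynomial.C : ℝ →+* MvPolynomial (Fin 2) ℝ)).det = 0 ∧
      MvPolynomial.eval p
        (MvPolynomial.X 0 * MvPolynomial.pderiv 0 (MvPolynomial.X 0 * MvPolynomial.pderiv 0 (∑ l, (MvPolynomial.X (0 : Fin 2) : MvPolynomial (Fin 2) ℝ) ^ d l •
              (S l).map (MvPolynomial.C : ℝ →+* MvPolynomial (Fin 2) ℝ)
            + (MvPolynomial.X (1 : Fin 2) : MvPolynomial (Fin 2) ℝ) •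
              (Matrix.fromBlocks 1 0 0 0 : Matrix (Fin m ⊕ Fin 0) (Fin m ⊕ Fin 0) ℝ).map
                (MvPolynomial.C : ℝ →+* MvPolynomial (Fin 2) ℝ)).det)
            * (MvPolynomial.X 1 * MvPolynomial.pderiv 1 (∑ l, (MvPolynomial.X (0 : Fin 2) : MvPolynomial (Fin 2) ℝ) ^ d l •
              (S l).map (MvPolynomial.C : ℝ →+* MvPolynomial (Fin 2) ℝ)
            + (MvPolynomial.X (1 : Fin 2) : MvPolynomial (Fin 2) ℝ) •
              (Matrix.fromBlocks 1 0 0 0 : Matrix (Fin m ⊕ Fin 0) (Fin m ⊕ Fin 0) ℝ).map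
                (MvPolynomial.C : ℝ →+* MvPolynomial (Fin 2) ℝ)).det) ^ 2
          - 2 * (MvPolynomial.X 0 * MvPolynomial.pderiv 0 (MvPolynomial.X 1 * MvPolynomial.pderiv 1 (∑ l, (MvPolynomial.X (0 : Fin 2) : MvPolynomial (Fin 2) ℝ) ^ d l •
              (S l).map (MvPolynomial.C : ℝ →+* MvPolynomial (Fin 2) ℝ)
            + (MvPolynomial.X (1 : Fin 2) : MvPolynomial (Fin 2) ℝ) •
              (Matrix.fromBlocks 1 0 0 0 : Matrix (Fin m ⊕ Fin 0) (Fin m ⊕ Fin 0) ℝ).map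
                (MvPolynomial.C : ℝ →+* MvPolynomial (Fin 2) ℝ)).det))
            * (MvPolynomial.X 0 * MvPolynomial.pderiv 0 (∑ l, (MvPolynomial.X (0 : Fin 2) : MvPolynomial (Fin 2) ℝ) ^ d l •
              (S l).map (MvPolynomial.C : ℝ →+* MvPolynomial (Fin 2) ℝ)
            + (MvPolynomial.X (1 : Fin 2) : MvPolynomial (Fin 2) ℝ) •
              (Matrix.fromBlocks 1 0 0 0 : Matrix (Fin m ⊕ Fin 0) (Fin m ⊕ Fin 0) ℝ).map
                (MvPolynomial.C : ℝ →+* MvPolynomial (Fin 2) ℝ)).det) * (MvPolynomial.X 1 * MvPolynomial.pderiv 1 (∑ l, (MvPolynomial.X (0 : Fin 2) : MvPolynomial (Fin 2) ℝ) ^ d l •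
              (S l).map (MvPolynomial.C : ℝ →+* MvPolynomial (Fin 2) ℝ)
            + (MvPolynomial.X (1 : Fin 2) : MvPolynomial (Fin 2) ℝ) •
              (Matrix.fromBlocks 1 0 0 0 : Matrix (Fin m ⊕ Fin 0) (Fin m ⊕ Fin 0) ℝ).map
                (MvPolynomial.C : ℝ →+* MvPolynomial (Fin 2) ℝ)).det)
          + MvPolynomial.X 1 * MvPolynomial.pderiv 1 (MvPolynomial.X 1 * MvPolynomial.pderiv 1 (∑ l, (MvPolynomial.X (0 : Fin 2) : MvPolynomial (Fin 2) ℝ) ^ d l •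
              (S l).map (MvPolynomial.C : ℝ →+* MvPolynomial (Fin 2) ℝ)
            + (MvPolynomial.X (1 : Fin 2) : MvPolynomial (Fin 2) ℝ) •
              (Matrix.fromBlocks 1 0 0 0 : Matrix (Fin m ⊕ Fin 0) (Fin m ⊕ Fin 0) ℝ).map
                (MvPolynomial.C : ℝ →+* MvPolynomial (Fin 2) ℝ)).det)
            * (MvPolynomial.X 0 * MvPolynomial.pderiv 0 (∑ l, (MvPolynomial.X (0 : Fin 2) : MvPolynomial (Fin 2) ℝ) ^ d l •
              (S l).map (MvPolynomial.C : ℝ →+* MvPolynomial (Fin 2) ℝ)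
            + (MvPolynomial.X (1 : Fin 2) : MvPolynomial (Fin 2) ℝ) •
              (Matrix.fromBlocks 1 0 0 0 : Matrix (Fin m ⊕ Fin 0) (Fin m ⊕ Fin 0) ℝ).map
                (MvPolynomial.C : ℝ →+* MvPolynomial (Fin 2) ℝ)).det) ^ 2) = 0}.Finite →
      (∀ p ∈ {p : Fin 2 → ℝ | 0 < p 0 ∧ 0 < p 1 ∧ MvPolynomial.eval p (∑ l, (MvPolynomial.X (0 : Fin 2) : MvPolynomial (Fin 2) ℝ) ^ d l •
              (S l).map (MvPolynomial.C : ℝ →+* MvPolynomial (Fin 2) ℝ)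
            + (MvPolynomial.X (1 : Fin 2) : MvPolynomial (Fin 2) ℝ) •
              (Matrix.fromBlocks 1 0 0 0 : Matrix (Fin m ⊕ Fin 0) (Fin m ⊕ Fin 0) ℝ).map
                (MvPolynomial.C : ℝ →+* MvPolynomial (Fin 2) ℝ)).det = 0 ∧
      MvPolynomial.eval p
        (MvPolynomial.X 0 * MvPolynomial.pderiv 0 (MvPolynomial.X 0 * MvPolynomial.pderiv 0 (∑ l, (MvPolynomial.X (0 : Fin 2) : MvPolynomial (Fin 2) ℝ) ^ d l •
              (S l).map (MvPolynomial.C : ℝ →+* MvPolynomial (Fin 2) ℝ)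
            + (MvPolynomial.X (1 : Fin 2) : MvPolynomial (Fin 2) ℝ) •
              (Matrix.fromBlocks 1 0 0 0 : Matrix (Fin m ⊕ Fin 0) (Fin m ⊕ Fin 0) ℝ).map
                (MvPolynomial.C : ℝ →+* MvPolynomial (Fin 2) ℝ)).det)
            * (MvPolynomial.X 1 * MvPolynomial.pderiv 1 (∑ l, (MvPolynomial.X (0 : Fin 2) : MvPolynomial (Fin 2) ℝ) ^ d l •
              (S l).map (MvPolynomial.C : ℝ →+* MvPolynomial (Fin 2) ℝ)
            + (MvPolynomial.X (1 : Fin 2) : MvPolynomial (Fin 2) ℝ) •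
              (Matrix.fromBlocks 1 0 0 0 : Matrix (Fin m ⊕ Fin 0) (Fin m ⊕ Fin 0) ℝ).map
                (MvPolynomial.C : ℝ →+* MvPolynomial (Fin 2) ℝ)).det) ^ 2
          - 2 * (MvPolynomial.X 0 * MvPolynomial.pderiv 0 (MvPolynomial.X 1 * MvPolynomial.pderiv 1 (∑ l, (MvPolynomial.X (0 : Fin 2) : MvPolynomial (Fin 2) ℝ) ^ d l •
              (S l).map (MvPolynomial.C : ℝ →+* MvPolynomial (Fin 2) ℝ)
            + (MvPolynomial.X (1 : Fin 2) : MvPolynomial (Fin 2) ℝ) •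
              (Matrix.fromBlocks 1 0 0 0 : Matrix (Fin m ⊕ Fin 0) (Fin m ⊕ Fin 0) ℝ).map
                (MvPolynomial.C : ℝ →+* MvPolynomial (Fin 2) ℝ)).det))
            * (MvPolynomial.X 0 * MvPolynomial.pderiv 0 (∑ l, (MvPolynomial.X (0 : Fin 2) : MvPolynomial (Fin 2) ℝ) ^ d l •
              (S l).map (MvPolynomial.C : ℝ →+* MvPolynomial (Fin 2) ℝ)
            + (MvPolynomial.X (1 : Fin 2) : MvPolynomial (Fin 2) ℝ) •
              (Matrix.fromBlocks 1 0 0 0 : Matrix (Fin m ⊕ Fin 0) (Fin m ⊕ Fin 0) ℝ).map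
                (MvPolynomial.C : ℝ →+* MvPolynomial (Fin 2) ℝ)).det) * (MvPolynomial.X 1 * MvPolynomial.pderiv 1 (∑ l, (MvPolynomial.X (0 : Fin 2) : MvPolynomial (Fin 2) ℝ) ^ d l •
              (S l).map (MvPolynomial.C : ℝ →+* MvPolynomial (Fin 2) ℝ)
            + (MvPolynomial.X (1 : Fin 2) : MvPolynomial (Fin 2) ℝ) •
              (Matrix.fromBlocks 1 0 0 0 : Matrix (Fin m ⊕ Fin 0) (Fin m ⊕ Fin 0) ℝ).map
                (MvPolynomial.C : ℝ →+* MvPolynomial (Fin 2) ℝ)).det)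
          + MvPolynomial.X 1 * MvPolynomial.pderiv 1 (MvPolynomial.X 1 * MvPolynomial.pderiv 1 (∑ l, (MvPolynomial.X (0 : Fin 2) : MvPolynomial (Fin 2) ℝ) ^ d l •
              (S l).map (MvPolynomial.C : ℝ →+* MvPolynomial (Fin 2) ℝ)
            + (MvPolynomial.X (1 : Fin 2) : MvPolynomial (Fin 2) ℝ) •
              (Matrix.fromBlocks 1 0 0 0 : Matrix (Fin m ⊕ Fin 0) (Fin m ⊕ Fin 0) ℝ).map
                (MvPolynomial.C : ℝ →+* MvPolynomial (Fin 2) ℝ)).det)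
            * (MvPolynomial.X 0 * MvPolynomial.pderiv 0 (∑ l, (MvPolynomial.X (0 : Fin 2) : MvPolynomial (Fin 2) ℝ) ^ d l •
              (S l).map (MvPolynomial.C : ℝ →+* MvPolynomial (Fin 2) ℝ)
            + (MvPolynomial.X (1 : Fin 2) : MvPolynomial (Fin 2) ℝ) •
              (Matrix.fromBlocks 1 0 0 0 : Matrix (Fin m ⊕ Fin 0) (Fin m ⊕ Fin 0) ℝ).map
                (MvPolynomial.C : ℝ →+* MvPolynomial (Fin 2) ℝ)).det) ^ 2) = 0},
          p 1 ≠ c * p 0 ^ N) →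
        Multiset.card ((∑ l, (X : ℝ[X]) ^ d l • (S l).map Polynomial.C
            + (Polynomial.C c * (X : ℝ[X]) ^ N) •
              (Matrix.fromBlocks 1 0 0 0 : Matrix (Fin m ⊕ Fin 0) (Fin m ⊕ Fin 0) ℝ).map Polynomial.C).det.roots.filter (fun t => 0 < t)) ≤
          2 * m * {p : Fin 2 → ℝ | 0 < p 0 ∧ 0 < p 1 ∧ MvPolynomial.eval p (∑ l, (MvPolynomial.X (0 : Fin 2) : MvPolynomial (Fin 2) ℝ) ^ d l •
              (S l).map (MvPolynomial.C : ℝ →+* MvPolynomial (Fin 2) ℝ)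
            + (MvPolynomial.X (1 : Fin 2) : MvPolynomial (Fin 2) ℝ) •
              (Matrix.fromBlocks 1 0 0 0 : Matrix (Fin m ⊕ Fin 0) (Fin m ⊕ Fin 0) ℝ).map
                (MvPolynomial.C : ℝ →+* MvPolynomial (Fin 2) ℝ)).det = 0 ∧
      MvPolynomial.eval p
        (MvPolynomial.X 0 * MvPolynomial.pderiv 0 (MvPolynomial.X 0 * MvPolynomial.pderiv 0 (∑ l, (MvPolynomial.X (0 : Fin 2) : MvPolynomial (Fin 2) ℝ) ^ d l •
              (S l).map (MvPolynomial.C : ℝ →+* MvPolynomial (Fin 2) ℝ)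
            + (MvPolynomial.X (1 : Fin 2) : MvPolynomial (Fin 2) ℝ) •
              (Matrix.fromBlocks 1 0 0 0 : Matrix (Fin m ⊕ Fin 0) (Fin m ⊕ Fin 0) ℝ).map
                (MvPolynomial.C : ℝ →+* MvPolynomial (Fin 2) ℝ)).det)
            * (MvPolynomial.X 1 * MvPolynomial.pderiv 1 (∑ l, (MvPolynomial.X (0 : Fin 2) : MvPolynomial (Fin 2) ℝ) ^ d l •
              (S l).map (MvPolynomial.C : ℝ →+* MvPolynomial (Fin 2) ℝ)
            + (MvPolynomial.X (1 : Fin 2) : MvPolynomial (Fin 2) ℝ) •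
              (Matrix.fromBlocks 1 0 0 0 : Matrix (Fin m ⊕ Fin 0) (Fin m ⊕ Fin 0) ℝ).map
                (MvPolynomial.C : ℝ →+* MvPolynomial (Fin 2) ℝ)).det) ^ 2
          - 2 * (MvPolynomial.X 0 * MvPolynomial.pderiv 0 (MvPolynomial.X 1 * MvPolynomial.pderiv 1 (∑ l, (MvPolynomial.X (0 : Fin 2) : MvPolynomial (Fin 2) ℝ) ^ d l •
              (S l).map (MvPolynomial.C : ℝ →+* MvPolynomial (Fin 2) ℝ)
            + (MvPolynomial.X (1 : Fin 2) : MvPolynomial (Fin 2) ℝ) •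
              (Matrix.fromBlocks 1 0 0 0 : Matrix (Fin m ⊕ Fin 0) (Fin m ⊕ Fin 0) ℝ).map
                (MvPolynomial.C : ℝ →+* MvPolynomial (Fin 2) ℝ)).det))
            * (MvPolynomial.X 0 * MvPolynomial.pderiv 0 (∑ l, (MvPolynomial.X (0 : Fin 2) : MvPolynomial (Fin 2) ℝ) ^ d l •
              (S l).map (MvPolynomial.C : ℝ →+* MvPolynomial (Fin 2) ℝ)
            + (MvPolynomial.X (1 : Fin 2) : MvPolynomial (Fin 2) ℝ) •
              (Matrix.fromBlocks 1 0 0 0 : Matrix (Fin m ⊕ Fin 0) (Fin m ⊕ Fin 0) ℝ).map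
                (MvPolynomial.C : ℝ →+* MvPolynomial (Fin 2) ℝ)).det) * (MvPolynomial.X 1 * MvPolynomial.pderiv 1 (∑ l, (MvPolynomial.X (0 : Fin 2) : MvPolynomial (Fin 2) ℝ) ^ d l •
              (S l).map (MvPolynomial.C : ℝ →+* MvPolynomial (Fin 2) ℝ)
            + (MvPolynomial.X (1 : Fin 2) : MvPolynomial (Fin 2) ℝ) •
              (Matrix.fromBlocks 1 0 0 0 : Matrix (Fin m ⊕ Fin 0) (Fin m ⊕ Fin 0) ℝ).map
                (MvPolynomial.C : ℝ →+* MvPolynomial (Fin 2) ℝ)).det)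
          + MvPolynomial.X 1 * MvPolynomial.pderiv 1 (MvPolynomial.X 1 * MvPolynomial.pderiv 1 (∑ l, (MvPolynomial.X (0 : Fin 2) : MvPolynomial (Fin 2) ℝ) ^ d l •
              (S l).map (MvPolynomial.C : ℝ →+* MvPolynomial (Fin 2) ℝ)
            + (MvPolynomial.X (1 : Fin 2) : MvPolynomial (Fin 2) ℝ) •
              (Matrix.fromBlocks 1 0 0 0 : Matrix (Fin m ⊕ Fin 0) (Fin m ⊕ Fin 0) ℝ).map
                (MvPolynomial.C : ℝ →+* MvPolynomial (Fin 2) ℝ)).det)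
            * (MvPolynomial.X 0 * MvPolynomial.pderiv 0 (∑ l, (MvPolynomial.X (0 : Fin 2) : MvPolynomial (Fin 2) ℝ) ^ d l •
              (S l).map (MvPolynomial.C : ℝ →+* MvPolynomial (Fin 2) ℝ)
            + (MvPolynomial.X (1 : Fin 2) : MvPolynomial (Fin 2) ℝ) •
              (Matrix.fromBlocks 1 0 0 0 : Matrix (Fin m ⊕ Fin 0) (Fin m ⊕ Fin 0) ℝ).map
                (MvPolynomial.C : ℝ →+* MvPolynomial (Fin 2) ℝ)).det) ^ 2) = 0}.ncard + 2 * m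
            + 2 * Multiset.card ((∑ l, (X : ℝ[X]) ^ d l • (S l).map Polynomial.C).det.roots.filter (fun t => 0 < t))
            + 3 * Multiset.card ((∑ l, (X : ℝ[X]) ^ d l • ((S l).toBlocks₂₂).map Polynomial.C).det.roots.filter (fun t => 0 < t)) := by
  intro K d S c N hS hc hf ha hfin hgp
  classical
  have ha0 : (∑ U ∈ (Finset.univ.map Function.Embedding.inl : Finset (Fin m ⊕ Fin 0)).powersetCard 0,
      (Matrix.of fun i j : Fin m ⊕ Fin 0 => if i ∈ U then (Pi.single i (1 : ℝ[X]) : Fin m ⊕ Fin 0 → ℝ[X]) j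
        else (∑ l, (X : ℝ[X]) ^ d l • (S l).map Polynomial.C) i j).det) ≠ 0 := by
    rw [OsculationLetter.coeff_zero]; exact hf
  have htop : (∑ U ∈ (Finset.univ.map Function.Embedding.inl : Finset (Fin m ⊕ Fin 0)).powersetCard m,
      (Matrix.of fun i j : Fin m ⊕ Fin 0 => if i ∈ U then (Pi.single i (1 : ℝ[X]) : Fin m ⊕ Fin 0 → ℝ[X]) j
        else (∑ l, (X : ℝ[X]) ^ d l • (S l).map Polynomial.C) i j).det) = 1 := by
    rw [OsculationLetter.coeff_top, lowerDet_fin_zero]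
  have key := peel_curve_prime m
    (fun k => ∑ U ∈ (Finset.univ.map Function.Embedding.inl : Finset (Fin m ⊕ Fin 0)).powersetCard k,
      (Matrix.of fun i j : Fin m ⊕ Fin 0 => if i ∈ U then (Pi.single i (1 : ℝ[X]) : Fin m ⊕ Fin 0 → ℝ[X]) j
        else (∑ l, (X : ℝ[X]) ^ d l • (S l).map Polynomial.C) i j).det)
    _ (OsculationLetter.insertionPoly_rank_card m 0 d S) htop
    (fun t _ => OsculationLetter.splits_letter_at m 0 d S hS t) hfin c N hc hgp ha0
  rw [OsculationLetter.coeff_zero] at key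
  rw [insertedDet_eq_rank]
  exact key.trans (Nat.le_add_right _ _)

end OsculationPeel

end Summit.ValiantsHypothesis.ValiantsHypothesis.Theorems.LacunarySymmetroidMatrixDescartes

end
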